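import Summits.NavierStokesRegularity.NavierStokesRegularity.Theorems.LerayQuarterDissipationFiniteDissipationLiouvilleFinalTrace
import Summits.NavierStokesRegularity.NavierStokesRegularity.Theorems.LerayQuarterDissipationFiniteDissipationLiouvilleApexPressureSlice
import HarnessLib

/-!
# Crux `FiniteDissipationLiouville` (stmt-NavierStokesRegularity-22144): the trace at the apex is
# attained at the Type-I RATE `(−t)^{1/4}`

Theorems file of route `LerayQuarterDissipation` (lead prover g3; `--supports` the crux). Navier–Stokes
regularity is NOT proved by anything here; no summit is.

For a member `u` of the stratum `𝒟` and a test field `φ`, the pairing `g(t) = ∫ ⟪u(t), φ⟫` converges to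
its trace value `L` as `t → 0⁻` (`…FinalTrace`). Here the RATE: `|g(t) − L| ≤ M (−t)^{1/4}` on
`(−1, 0)` (`exists_trace_rate`). Proof: `g(t) − g(s) = ∫_s^t F` (Leray's pairing identity with
pressure below the apex) with the flux bounded by `c₁(−τ)^{−1/2} + c₂ + c₃(−τ)^{−3/4}` — the velocity
part through `∫_B |u(τ)|² ≲ ‖u(τ)‖²_{L⁶} ≲ (−τ)^{−1/2}` (Chae–Wolf (2.4a) at `q = 6`), the pressure part
through the slice bound `∫_B |p(τ)|^{3/2} ≲ (−τ)^{−3/4}` of the gauged Calderón–Zygmund pressure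
(`…ApexPressureSlice`) — and `∫_t^0 (−τ)^{−3/4} dτ = 4(−t)^{1/4}`. So the distributional trace of a
Type-I finite-dissipation profile is attained in `𝒟'` at the parabolic rate `(−t)^{1/4} = √(√(−t))`.

References: J. Leray, Acta Math. 63 (1934) §III (17); D. Chae, J. Wolf, arXiv:1610.09464, §2 Step 2.
-/

noncomputable section

-- the summit and its single sub-problem share the name (CONVENTIONS §1), as in every Theorems file
set_option linter.dupNamespace false

namespace Summit.NavierStokesRegularity.NavierStokesRegularity.Theorems.FiniteDissipationLiouville.Birth.Apex

open MeasureTheory Set Filter Topology Metric Function TopologicalSpace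
open Literature.Analysis Literature.Analysis.FluidPDE
open scoped ENNReal NNReal RealInnerProductSpace Laplacian

variable {C K : ℝ} {u : ℝ → EuclideanSpace ℝ (Fin 3) → EuclideanSpace ℝ (Fin 3)}

/-! ### Integrals of the rate powers -/

/-- `∫_s^t (1 − τ)^r dτ ≤ (1 − s)^{r+1}/(r+1)` for `−1 < r`, `t ≤ 1`. -/
theorem integral_one_sub_rpow_le {r s t : ℝ} (hr : -1 < r) (ht : t ≤ 1) :
    ∫ τ in s..t, (1 - τ) ^ r ≤ (1 - s) ^ (r + 1) / (r + 1) := by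
  have h1 : ∫ τ in s..t, (1 - τ) ^ r = ∫ x in (1 - t)..(1 - s), x ^ r := by
    rw [intervalIntegral.integral_comp_sub_left (fun x => x ^ r) 1]
  rw [h1, integral_rpow (Or.inl hr)]
  have hr1 : 0 < r + 1 := by linarith
  have h2 : 0 ≤ (1 - t) ^ (r + 1) := Real.rpow_nonneg (by linarith) _
  have h3 : ((1 - s) ^ (r + 1) - (1 - t) ^ (r + 1)) / (r + 1) ≤ (1 - s) ^ (r + 1) / (r + 1) :=
    div_le_div_of_nonneg_right (by linarith) hr1.le
  exact h3

/-- `(1 − s)^a ≤ (1 − s)^{1/4}` for `0 ≤ s < 1` and `1/4 ≤ a`. -/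
theorem one_sub_rpow_le_quarter {s a : ℝ} (hs0 : 0 ≤ s) (hs1 : s < 1) (ha : (1 / 4 : ℝ) ≤ a) :
    (1 - s) ^ a ≤ (1 - s) ^ (1 / 4 : ℝ) :=
  Real.rpow_le_rpow_of_exponent_ge (by linarith) (by linarith) ha

/-! ### The rate -/

/-- **The trace at the apex is attained at the rate `(−t)^{1/4}`.** For a member of the stratum and
a test field `φ` there are `L` (the trace value) and `M` with `∫ ⟪u(t), φ⟫ → L` as `t → 0⁻` and
`|∫ ⟪u(t), φ⟫ − L| ≤ M (−t)^{1/4}` for `t ∈ (−1, 0)`. -/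
theorem exists_trace_rate (hu : IsTypeIAncientMild C u)
    (hlaw : ∀ s : ℝ, s < 0 → ∫⁻ x, ‖fderiv ℝ (u s) x‖ₑ ^ 2 ≤ ENNReal.ofReal (K / Real.sqrt (-s)))
    {φ : EuclideanSpace ℝ (Fin 3) → EuclideanSpace ℝ (Fin 3)}
    (hφ : FunctionSpaces.IsTestFunctionOn (⊤ : Opens (EuclideanSpace ℝ (Fin 3))) φ) :
    ∃ L M : ℝ, Tendsto (fun t => ∫ x, ⟪u t x, φ x⟫) (𝓝[<] 0) (𝓝 L) ∧
      ∀ t ∈ Ioo (-1 : ℝ) 0, |(∫ x, ⟪u t x, φ x⟫) - L| ≤ M * (-t) ^ (1 / 4 : ℝ) := by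
  obtain ⟨L, hL⟩ := exists_tendsto_pairing_finalSlice hu hlaw hφ
  obtain ⟨p, hsol, hslice⟩ := exists_normalised_pressure_sliceBound hu hlaw
  obtain ⟨A, hA0, hA⟩ := exists_eLpNorm_six_rate hu hlaw
  have hcl := isClassicalNSSolutionOn_shift hsol 1
  -- the test field: support ball and bounds
  obtain ⟨R, hR0, hR⟩ := hφ.hasCompactSupport.isCompact.isBounded.subset_ball_lt 0
    (0 : EuclideanSpace ℝ (Fin 3))
  obtain ⟨D, hD0, hD⟩ := hslice 1 R one_pos hR0
  obtain ⟨K₀, K₁, K₂, hK₀, hK₁, hK₂⟩ := exists_bounds_of_isTestFunctionOn hφ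
  have hK₁0 : 0 ≤ K₁ := (norm_nonneg _).trans (hK₁ 0)
  have hK₂0 : 0 ≤ K₂ := (norm_nonneg _).trans (hK₂ 0)
  have hφ2 : ContDiff ℝ 2 φ := hφ.contDiff.of_le (by norm_cast)
  have hφ1 : ContDiff ℝ 1 φ := hφ.contDiff.of_le (by norm_cast)
  set K₃ : ℝ := 3 * K₁ with hK₃def
  have hK₃ : ∀ x, ‖VectorCalculus.divergence φ x‖ ≤ K₃ := fun x => norm_divergence_le_three_mul hK₁ x
  have hK₃0 : 0 ≤ K₃ := (norm_nonneg _).trans (hK₃ 0)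
  have hφ0 : ∀ x ∉ ball (0 : EuclideanSpace ℝ (Fin 3)) R, φ x = 0 := fun x hx =>
    image_eq_zero_of_notMem_tsupport fun h => hx (hR h)
  have hDφ0 : ∀ x ∉ ball (0 : EuclideanSpace ℝ (Fin 3)) R, fderiv ℝ φ x = 0 := fun x hx =>
    fderiv_of_notMem_tsupport ℝ fun h => hx (hR h)
  have hΔφ0 : ∀ x ∉ ball (0 : EuclideanSpace ℝ (Fin 3)) R, Δ φ x = 0 := fun x hx =>
    laplacian_eq_zero_of_notMem_tsupport fun h => hx (hR h)
  have hdiv0 : ∀ x ∉ ball (0 : EuclideanSpace ℝ (Fin 3)) R, VectorCalculus.divergence φ x = 0 :=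
    fun x hx => divergence_eq_zero_of_notMem_tsupport fun h => hx (hR h)
  -- the shifted pair and the flux
  set v : ℝ → EuclideanSpace ℝ (Fin 3) → EuclideanSpace ℝ (Fin 3) := fun t => u (t - 1) with hv
  set q : ℝ → EuclideanSpace ℝ (Fin 3) → ℝ := fun t => p (t - 1) with hq
  set Aτ : ℝ → ℝ := fun τ => ∫ x, (⟪v τ x, convect (v τ) φ x⟫ + 1 * ⟪v τ x, (Δ φ) x⟫ +
    ⟪(0 : ℝ → EuclideanSpace ℝ (Fin 3) → EuclideanSpace ℝ (Fin 3)) τ x, φ x⟫) with hAτ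
  set Pτ : ℝ → ℝ := fun τ => ∫ x, q τ x * VectorCalculus.divergence φ x with hPτ
  set F : ℝ → ℝ := fun τ => Aτ τ + Pτ τ with hF
  -- ### the pairing identity on `[0, t]`, `t < 1`
  have hid : ∀ t ∈ Ioo (0 : ℝ) 1,
      (∫ x, ⟪v t x, φ x⟫) - ∫ x, ⟪v 0 x, φ x⟫ = ∫ τ in 0..t, F τ := by
    intro t ht
    have hclt : IsClassicalNSSolutionOn (Icc 0 t) 1 0 v q :=
      hcl.mono (Icc_subset_Ico_right ht.2) (uniqueDiffOn_Icc ht.1)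
    exact hclt.integral_inner_sub_eq_pressure ht.1 hφ2 hφ.hasCompactSupport le_rfl ht.1.le le_rfl
  -- ### continuity of the flux on `[0, 1)`
  have hsubv : Ico (0 : ℝ) 1 ×ˢ (univ : Set (EuclideanSpace ℝ (Fin 3))) ⊆
      (fun z : ℝ × EuclideanSpace ℝ (Fin 3) => (z.1 - 1, z.2)) ⁻¹' (Iio 0 ×ˢ univ) := by
    intro z hz
    exact ⟨by have := (mem_prod.1 hz).1.2; show z.1 - 1 < 0; linarith, mem_univ _⟩
  have hshift : Continuous fun z : ℝ × EuclideanSpace ℝ (Fin 3) => (z.1 - 1, z.2) := by fun_prop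
  have hvc : ContinuousOn (uncurry v) (Ico 0 1 ×ˢ univ) :=
    (hu.continuousOn_uncurry.comp hshift.continuousOn hsubv :)
  have hqc : ContinuousOn (uncurry q) (Ico 0 1 ×ˢ univ) :=
    (hsol.smooth_pressure.continuousOn.comp hshift.continuousOn hsubv :)
  have hAc : ContinuousOn Aτ (Ico 0 1) := by
    refine continuousOn_integral_of_support_subset (μ := volume) (K := closedBall (0 : EuclideanSpace ℝ (Fin 3)) R)
      (isCompact_closedBall 0 R) ?_ ?_
    · have h1 : ContinuousOn (fun z : ℝ × EuclideanSpace ℝ (Fin 3) => uncurry v z)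
          (Ico 0 1 ×ˢ univ) := hvc
      have h2 : Continuous fun z : ℝ × EuclideanSpace ℝ (Fin 3) => fderiv ℝ φ z.2 :=
        (hφ1.continuous_fderiv one_ne_zero).comp continuous_snd
      have h3 : Continuous fun z : ℝ × EuclideanSpace ℝ (Fin 3) => (Δ φ) z.2 :=
        (continuous_laplacian hφ2).comp continuous_snd
      have h4 : ContinuousOn (fun z : ℝ × EuclideanSpace ℝ (Fin 3) => fderiv ℝ φ z.2 (uncurry v z))
          (Ico 0 1 ×ˢ univ) := h2.continuousOn.clm_apply h1
      have h5 : ContinuousOn (fun z : ℝ × EuclideanSpace ℝ (Fin 3) =>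
          ⟪uncurry v z, fderiv ℝ φ z.2 (uncurry v z)⟫ + 1 * ⟪uncurry v z, (Δ φ) z.2⟫ +
            ⟪(0 : EuclideanSpace ℝ (Fin 3)), φ z.2⟫) (Ico 0 1 ×ˢ univ) :=
        ((h1.inner h4).add (continuousOn_const.mul (h1.inner h3.continuousOn))).add
          (continuousOn_const.inner (hφ.contDiff.continuous.comp continuous_snd).continuousOn)
      refine h5.congr fun z _ => ?_
      simp only [uncurry, convect_apply, Pi.zero_apply]
    · intro τ _ x hx
      have hx' : x ∉ ball (0 : EuclideanSpace ℝ (Fin 3)) R := fun h => hx (ball_subset_closedBall h)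
      have e1 : convect (v τ) φ x = 0 := by rw [convect_apply, hDφ0 x hx']; rfl
      rw [e1, hΔφ0 x hx', hφ0 x hx']
      simp
  have hPc : ContinuousOn Pτ (Ico 0 1) := by
    refine continuousOn_integral_of_support_subset (μ := volume) (K := closedBall (0 : EuclideanSpace ℝ (Fin 3)) R)
      (isCompact_closedBall 0 R) ?_ ?_
    · exact hqc.mul ((continuous_divergence (hφ1.continuous_fderiv one_ne_zero)).comp
        continuous_snd).continuousOn
    · intro τ _ x hx
      have hx' : x ∉ ball (0 : EuclideanSpace ℝ (Fin 3)) R := fun h => hx (ball_subset_closedBall h)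
      simp only [hdiv0 x hx', mul_zero]
  have hFc : ContinuousOn F (Ico 0 1) := hAc.add hPc
  -- ### the velocity piece: `|A τ| ≤ c₁ (1 − τ)^{−1/2} + c₂`
  set VB : ℝ := (volume : Measure (EuclideanSpace ℝ (Fin 3))).real (closedBall (0 : EuclideanSpace ℝ (Fin 3)) R)
    with hVB
  have hVB0 : 0 ≤ VB := measureReal_nonneg
  set κ : ℝ := (6 - 3) / (2 * 6) with hκ
  set c₁ : ℝ := (K₁ + K₂) * (VB ^ (1 - 2 / 6 : ℝ) * A ^ 2) with hc₁
  set c₂ : ℝ := K₂ * VB with hc₂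
  have hc₁0 : 0 ≤ c₁ := by positivity
  have hc₂0 : 0 ≤ c₂ := by positivity
  have hAbound : ∀ τ ∈ Ioo (0 : ℝ) 1, ‖Aτ τ‖ ≤ c₁ * (1 - τ) ^ (-(1 / 2 : ℝ)) + c₂ := by
    intro τ hτ
    have hτ1 : τ - 1 < 0 := by linarith [hτ.2]
    have h1τ : 0 ≤ 1 - τ := by linarith [hτ.2]
    have hvτ : Continuous (v τ) := hu.continuous_slice hτ1
    set M : ℝ≥0 := (A * (1 - τ) ^ (-κ)).toNNReal with hM
    have hMval : (M : ℝ) = A * (1 - τ) ^ (-κ) :=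
      Real.coe_toNNReal _ (mul_nonneg hA0 (Real.rpow_nonneg h1τ _))
    have hvM : eLpNorm (v τ) (ENNReal.ofReal 6) volume ≤ M := by
      have h := (hA (τ - 1) hτ1).2
      rw [show -(τ - 1) = 1 - τ by ring] at h
      exact h
    have hsq := ChaeWolfEnergy.setIntegral_norm_sq_le (0 : EuclideanSpace ℝ (Fin 3)) R hvτ
      (by norm_num : (2 : ℝ) ≤ 6) hvM
    rw [hMval] at hsq
    have hpt : ∀ x, ‖⟪v τ x, convect (v τ) φ x⟫ + 1 * ⟪v τ x, (Δ φ) x⟫ +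
        ⟪(0 : ℝ → EuclideanSpace ℝ (Fin 3) → EuclideanSpace ℝ (Fin 3)) τ x, φ x⟫‖ ≤
        (closedBall (0 : EuclideanSpace ℝ (Fin 3)) R).indicator
          (fun x => (K₁ + K₂) * ‖v τ x‖ ^ 2 + K₂) x := by
      intro x
      by_cases hx : x ∈ closedBall (0 : EuclideanSpace ℝ (Fin 3)) R
      · rw [indicator_of_mem hx]
        exact norm_flux_integrand_le (a := v τ x) (e := φ x) (hK₁ x) (hK₂ x) hK₂0
      · rw [indicator_of_notMem hx]
        have hx' : x ∉ ball (0 : EuclideanSpace ℝ (Fin 3)) R := fun h => hx (ball_subset_closedBall h)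
        have e1 : convect (v τ) φ x = 0 := by rw [convect_apply, hDφ0 x hx']; rfl
        rw [e1, hΔφ0 x hx', hφ0 x hx']
        simp
    have hint : Integrable ((closedBall (0 : EuclideanSpace ℝ (Fin 3)) R).indicator
        (fun x => (K₁ + K₂) * ‖v τ x‖ ^ 2 + K₂)) volume := by
      refine (((continuous_const.mul (hvτ.norm.pow 2)).add continuous_const).continuousOn.integrableOn_compact
        (isCompact_closedBall (0 : EuclideanSpace ℝ (Fin 3)) R)).integrable_indicator measurableSet_closedBall
    have hpow : (A * (1 - τ) ^ (-κ)) ^ 2 = A ^ 2 * (1 - τ) ^ (-(1 / 2 : ℝ)) := by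
      rw [mul_pow, ← Real.rpow_natCast ((1 - τ) ^ (-κ)) 2, ← Real.rpow_mul h1τ, hκ]
      norm_num
    calc ‖Aτ τ‖ ≤ ∫ x, (closedBall (0 : EuclideanSpace ℝ (Fin 3)) R).indicator
          (fun x => (K₁ + K₂) * ‖v τ x‖ ^ 2 + K₂) x :=
          norm_integral_le_of_norm_le hint (Eventually.of_forall hpt)
      _ = ∫ x in closedBall (0 : EuclideanSpace ℝ (Fin 3)) R, ((K₁ + K₂) * ‖v τ x‖ ^ 2 + K₂) :=
          integral_indicator measurableSet_closedBall
      _ = (K₁ + K₂) * (∫ x in closedBall (0 : EuclideanSpace ℝ (Fin 3)) R, ‖v τ x‖ ^ 2) + K₂ * VB := by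
          have i1 : IntegrableOn (fun x => ‖v τ x‖ ^ 2) (closedBall (0 : EuclideanSpace ℝ (Fin 3)) R) :=
            (hvτ.norm.pow 2).continuousOn.integrableOn_compact (isCompact_closedBall _ _)
          rw [integral_add (i1.const_mul _) (integrableOn_const measure_closedBall_lt_top.ne),
            integral_const_mul, setIntegral_const, smul_eq_mul, hVB, mul_comm _ K₂]
      _ ≤ (K₁ + K₂) * (VB ^ (1 - 2 / 6 : ℝ) * (A * (1 - τ) ^ (-κ)) ^ 2) + K₂ * VB :=
          add_le_add (mul_le_mul_of_nonneg_left hsq (add_nonneg hK₁0 hK₂0)) le_rfl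
      _ = c₁ * (1 - τ) ^ (-(1 / 2 : ℝ)) + c₂ := by rw [hpow, hc₁, hc₂]; ring
  -- ### the pressure piece: `|P τ| ≤ c₃ (1 − τ)^{−3/4} + c₄`
  set Vb : ℝ := (volume : Measure (EuclideanSpace ℝ (Fin 3))).real (ball (0 : EuclideanSpace ℝ (Fin 3)) R)
    with hVb
  have hVb0 : 0 ≤ Vb := measureReal_nonneg
  set c₃ : ℝ := K₃ * (2 / 3 * D) with hc₃
  set c₄ : ℝ := K₃ * (1 / 3 * Vb) with hc₄
  have hc₃0 : 0 ≤ c₃ := by positivity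
  have hc₄0 : 0 ≤ c₄ := by positivity
  have hPbound : ∀ τ ∈ Ioo (0 : ℝ) 1, ‖Pτ τ‖ ≤ c₃ * (1 - τ) ^ (-(3 / 4 : ℝ)) + c₄ := by
    intro τ hτ
    have hτ1 : τ - 1 < 0 := by linarith [hτ.2]
    have h1τ : 0 ≤ 1 - τ := by linarith [hτ.2]
    have hqτ : Continuous (q τ) := (hsol.contDiff_pressure (hτ1 : τ - 1 ∈ Iio 0)).continuous
    have i32 : IntegrableOn (fun x => |q τ x| ^ (3 / 2 : ℝ)) (ball (0 : EuclideanSpace ℝ (Fin 3)) R) := by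
      refine ((Real.continuous_rpow_const (by norm_num)).comp (continuous_abs.comp hqτ)).continuousOn.integrableOn_compact
        (isCompact_closedBall (0 : EuclideanSpace ℝ (Fin 3)) R) |>.mono_set ball_subset_closedBall
    -- the slice bound in real form
    have hsl : ∫ x in ball (0 : EuclideanSpace ℝ (Fin 3)) R, |q τ x| ^ (3 / 2 : ℝ) ≤
        D * (1 - τ) ^ (-(3 / 4 : ℝ)) := by
      have h := hD (τ - 1) ⟨by linarith [hτ.1], hτ1⟩
      rw [show -(τ - 1) = 1 - τ by ring] at h
      have e : ∫⁻ x in ball (0 : EuclideanSpace ℝ (Fin 3)) R, ‖q τ x‖ₑ ^ (3 / 2 : ℝ) =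
          ENNReal.ofReal (∫ x in ball (0 : EuclideanSpace ℝ (Fin 3)) R, |q τ x| ^ (3 / 2 : ℝ)) := by
        rw [ofReal_integral_eq_lintegral_ofReal i32 (ae_of_all _ fun x => by positivity)]
        refine lintegral_congr fun x => ?_
        rw [Real.enorm_eq_ofReal_abs, ENNReal.ofReal_rpow_of_nonneg (abs_nonneg _) (by norm_num)]
      have e2 : (-(3 * ((6 - 3) / (2 * 6) : ℝ))) = (-(3 / 4 : ℝ)) := by norm_num
      rw [e2] at h
      have h' : ENNReal.ofReal (∫ x in ball (0 : EuclideanSpace ℝ (Fin 3)) R, |q τ x| ^ (3 / 2 : ℝ)) ≤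
          ENNReal.ofReal (D * (1 - τ) ^ (-(3 / 4 : ℝ))) := by rw [← e]; exact h
      exact (ENNReal.ofReal_le_ofReal_iff (mul_nonneg hD0 (Real.rpow_nonneg h1τ _))).1 h'
    have hpt : ∀ x, ‖q τ x * VectorCalculus.divergence φ x‖ ≤
        (ball (0 : EuclideanSpace ℝ (Fin 3)) R).indicator
          (fun x => K₃ * (2 / 3 * |q τ x| ^ (3 / 2 : ℝ) + 1 / 3)) x := by
      intro x
      by_cases hx : x ∈ ball (0 : EuclideanSpace ℝ (Fin 3)) R
      · rw [indicator_of_mem hx, norm_mul, Real.norm_eq_abs]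
        calc |q τ x| * ‖VectorCalculus.divergence φ x‖ ≤ |q τ x| * K₃ := by gcongr; exact hK₃ x
          _ = K₃ * |q τ x| := mul_comm _ _
          _ ≤ K₃ * (2 / 3 * |q τ x| ^ (3 / 2 : ℝ) + 1 / 3) :=
              mul_le_mul_of_nonneg_left (le_twoThirds_rpow_add (abs_nonneg _)) hK₃0
      · rw [indicator_of_notMem hx, hdiv0 x hx, mul_zero, norm_zero]
    have hint : Integrable ((ball (0 : EuclideanSpace ℝ (Fin 3)) R).indicator
        (fun x => K₃ * (2 / 3 * |q τ x| ^ (3 / 2 : ℝ) + 1 / 3))) volume := by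
      refine IntegrableOn.integrable_indicator ?_ measurableSet_ball
      exact ((i32.const_mul _).add (integrableOn_const measure_ball_lt_top.ne)).const_mul _
    calc ‖Pτ τ‖ ≤ ∫ x, (ball (0 : EuclideanSpace ℝ (Fin 3)) R).indicator
          (fun x => K₃ * (2 / 3 * |q τ x| ^ (3 / 2 : ℝ) + 1 / 3)) x :=
          norm_integral_le_of_norm_le hint (Eventually.of_forall hpt)
      _ = ∫ x in ball (0 : EuclideanSpace ℝ (Fin 3)) R, K₃ * (2 / 3 * |q τ x| ^ (3 / 2 : ℝ) + 1 / 3) :=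
          integral_indicator measurableSet_ball
      _ = K₃ * (2 / 3 * (∫ x in ball (0 : EuclideanSpace ℝ (Fin 3)) R, |q τ x| ^ (3 / 2 : ℝ)) + 1 / 3 * Vb) := by
          rw [integral_const_mul, integral_add (i32.const_mul _) (integrableOn_const measure_ball_lt_top.ne),
            integral_const_mul, setIntegral_const, smul_eq_mul, hVb, mul_comm _ (1 / 3 : ℝ)]
      _ ≤ K₃ * (2 / 3 * (D * (1 - τ) ^ (-(3 / 4 : ℝ))) + 1 / 3 * Vb) := by gcongr
      _ = c₃ * (1 - τ) ^ (-(3 / 4 : ℝ)) + c₄ := by rw [hc₃, hc₄]; ring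
  -- ### the flux majorant and the increment bound
  set maj : ℝ → ℝ := fun τ => c₁ * (1 - τ) ^ (-(1 / 2 : ℝ)) + c₂ + (c₃ * (1 - τ) ^ (-(3 / 4 : ℝ)) + c₄)
    with hmaj
  have hFle : ∀ τ ∈ Ioo (0 : ℝ) 1, ‖F τ‖ ≤ maj τ := fun τ hτ =>
    (norm_add_le _ _).trans (add_le_add (hAbound τ hτ) (hPbound τ hτ))
  set Mc : ℝ := 2 * c₁ + c₂ + 4 * c₃ + c₄ with hMc
  have hincr : ∀ s t : ℝ, 0 < s → s ≤ t → t < 1 →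
      |(∫ x, ⟪v t x, φ x⟫) - ∫ x, ⟪v s x, φ x⟫| ≤ Mc * (1 - s) ^ (1 / 4 : ℝ) := by
    intro s t hs hst ht
    have hs1 : s < 1 := lt_of_le_of_lt hst ht
    -- `g(t) − g(s) = ∫_s^t F`
    have e1 := hid t ⟨hs.trans_le hst, ht⟩
    have e2 := hid s ⟨hs, hs1⟩
    have hFi : IntervalIntegrable F volume 0 t :=
      (hFc.mono (Icc_subset_Ico_right ht)).intervalIntegrable_of_Icc (hs.trans_le hst).le
    have hFi' : IntervalIntegrable F volume 0 s :=
      (hFc.mono (Icc_subset_Ico_right hs1)).intervalIntegrable_of_Icc hs.le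
    have e3 : (∫ x, ⟪v t x, φ x⟫) - ∫ x, ⟪v s x, φ x⟫ = ∫ τ in s..t, F τ := by
      rw [← intervalIntegral.integral_add_adjacent_intervals hFi' (hFi'.symm.trans hFi)] at e1
      linarith
    rw [e3]
    -- bound the interval integral by the majorant
    have hmajc : ContinuousOn maj (Icc s t) := by
      have h1 : ∀ a : ℝ, ContinuousOn (fun τ : ℝ => (1 - τ) ^ a) (Icc s t) := fun a =>
        ContinuousOn.rpow_const (continuousOn_const.sub continuousOn_id) fun τ hτ =>
          Or.inl (by have := hτ.2; exact (show (1 : ℝ) - τ ≠ 0 by linarith))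
      exact (((continuousOn_const.mul (h1 _)).add continuousOn_const).add
        ((continuousOn_const.mul (h1 _)).add continuousOn_const))
    have hFis : IntervalIntegrable F volume s t :=
      (hFc.mono (Icc_subset_Ico_right ht |>.trans' (Icc_subset_Icc hs.le le_rfl))).intervalIntegrable_of_Icc hst
    have hmaji : IntervalIntegrable maj volume s t := hmajc.intervalIntegrable_of_Icc hst
    have h1 : |∫ τ in s..t, F τ| ≤ ∫ τ in s..t, maj τ := by
      rw [← Real.norm_eq_abs]
      refine (intervalIntegral.norm_integral_le_integral_norm hst).trans ?_
      exact intervalIntegral.integral_mono_on hst hFis.norm hmaji fun τ hτ => by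
        rcases eq_or_lt_of_le hτ.2 with h | h
        · -- endpoint `τ = t`: use continuity bound via the open interval? fall back to `Ioo` version
          subst h
          exact hFle τ ⟨hs.trans_le hτ.1, ht⟩
        · exact hFle τ ⟨hs.trans_le hτ.1, h.trans ht⟩
    refine h1.trans ?_
    -- integrate the majorant
    have i1 := integral_one_sub_rpow_le (s := s) (r := -(1 / 2 : ℝ)) (by norm_num) ht.le
    have i2 := integral_one_sub_rpow_le (s := s) (r := -(3 / 4 : ℝ)) (by norm_num) ht.le
    have i1' : (∫ τ in s..t, (1 - τ) ^ (-(1 / 2 : ℝ))) ≤ 2 * (1 - s) ^ (1 / 4 : ℝ) := by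
      have e : (-(1 / 2 : ℝ) + 1) = 1 / 2 := by norm_num
      rw [e] at i1
      have hq : (1 - s) ^ (1 / 2 : ℝ) ≤ (1 - s) ^ (1 / 4 : ℝ) :=
        one_sub_rpow_le_quarter hs.le hs1 (by norm_num)
      calc (∫ τ in s..t, (1 - τ) ^ (-(1 / 2 : ℝ))) ≤ (1 - s) ^ (1 / 2 : ℝ) / (1 / 2) := i1
        _ = 2 * (1 - s) ^ (1 / 2 : ℝ) := by ring
        _ ≤ 2 * (1 - s) ^ (1 / 4 : ℝ) := by linarith
    have i2' : (∫ τ in s..t, (1 - τ) ^ (-(3 / 4 : ℝ))) ≤ 4 * (1 - s) ^ (1 / 4 : ℝ) := by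
      have e : (-(3 / 4 : ℝ) + 1) = 1 / 4 := by norm_num
      rw [e] at i2
      calc (∫ τ in s..t, (1 - τ) ^ (-(3 / 4 : ℝ))) ≤ (1 - s) ^ (1 / 4 : ℝ) / (1 / 4) := i2
        _ = 4 * (1 - s) ^ (1 / 4 : ℝ) := by ring
    have hq3 : (t - s) ≤ (1 - s) ^ (1 / 4 : ℝ) := by
      have h1' : t - s ≤ (1 - s) ^ (1 : ℝ) := by rw [Real.rpow_one]; linarith
      exact h1'.trans (one_sub_rpow_le_quarter hs.le hs1 (by norm_num))
    have hr0 : 0 ≤ (1 - s) ^ (1 / 4 : ℝ) := Real.rpow_nonneg (by linarith) _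
    have ic₁ : IntervalIntegrable (fun τ : ℝ => (1 - τ) ^ (-(1 / 2 : ℝ))) volume s t :=
      ((ContinuousOn.rpow_const (continuousOn_const.sub continuousOn_id)
        fun τ (hτ : τ ∈ Icc s t) => Or.inl (by have := hτ.2; exact (show (1 : ℝ) - τ ≠ 0 by linarith)) :
          ContinuousOn (fun τ : ℝ => (1 - τ) ^ (-(1 / 2 : ℝ))) (Icc s t))).intervalIntegrable_of_Icc hst
    have ic₃ : IntervalIntegrable (fun τ : ℝ => (1 - τ) ^ (-(3 / 4 : ℝ))) volume s t :=
      ((ContinuousOn.rpow_const (continuousOn_const.sub continuousOn_id)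
        fun τ (hτ : τ ∈ Icc s t) => Or.inl (by have := hτ.2; exact (show (1 : ℝ) - τ ≠ 0 by linarith)) :
          ContinuousOn (fun τ : ℝ => (1 - τ) ^ (-(3 / 4 : ℝ))) (Icc s t))).intervalIntegrable_of_Icc hst
    have esplit : ∫ τ in s..t, maj τ =
        c₁ * (∫ τ in s..t, (1 - τ) ^ (-(1 / 2 : ℝ))) + c₂ * (t - s) +
          (c₃ * (∫ τ in s..t, (1 - τ) ^ (-(3 / 4 : ℝ))) + c₄ * (t - s)) := by
      rw [hmaj]
      rw [intervalIntegral.integral_add ((ic₁.const_mul c₁).add intervalIntegrable_const)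
        ((ic₃.const_mul c₃).add intervalIntegrable_const),
        intervalIntegral.integral_add (ic₁.const_mul c₁) intervalIntegrable_const,
        intervalIntegral.integral_add (ic₃.const_mul c₃) intervalIntegrable_const]
      simp only [intervalIntegral.integral_const_mul, intervalIntegral.integral_const, smul_eq_mul]
      ring
    rw [esplit, hMc]
    have j1 : c₁ * (∫ τ in s..t, (1 - τ) ^ (-(1 / 2 : ℝ))) ≤ c₁ * (2 * (1 - s) ^ (1 / 4 : ℝ)) :=
      mul_le_mul_of_nonneg_left i1' hc₁0
    have j2 : c₃ * (∫ τ in s..t, (1 - τ) ^ (-(3 / 4 : ℝ))) ≤ c₃ * (4 * (1 - s) ^ (1 / 4 : ℝ)) :=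
      mul_le_mul_of_nonneg_left i2' hc₃0
    have j3 : c₂ * (t - s) ≤ c₂ * (1 - s) ^ (1 / 4 : ℝ) := mul_le_mul_of_nonneg_left hq3 hc₂0
    have j4 : c₄ * (t - s) ≤ c₄ * (1 - s) ^ (1 / 4 : ℝ) := mul_le_mul_of_nonneg_left hq3 hc₄0
    linarith
  -- ### pass to the limit `t → 1⁻` in the increment bound
  have hgv : Tendsto (fun t => ∫ x, ⟪v t x, φ x⟫) (𝓝[<] 1) (𝓝 L) := by
    have hmap : Tendsto (fun s : ℝ => s - 1) (𝓝[<] 1) (𝓝[<] 0) := by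
      refine tendsto_nhdsWithin_of_tendsto_nhds_of_eventually_within _ ?_ ?_
      · have h := (continuous_sub_right (1 : ℝ)).tendsto 1
        simpa using h.mono_left nhdsWithin_le_nhds
      · filter_upwards [self_mem_nhdsWithin] with s hs
        show s - 1 < 0
        have hs' : s < 1 := hs
        linarith
    exact hL.comp hmap
  refine ⟨L, Mc, hL, fun t ht => ?_⟩
  -- `s = t + 1 ∈ (0, 1)`
  have hs : 0 < t + 1 := by linarith [ht.1]
  have hs1 : t + 1 < 1 := by linarith [ht.2]
  have hlim : Tendsto (fun t' => |(∫ x, ⟪v t' x, φ x⟫) - ∫ x, ⟪v (t + 1) x, φ x⟫|) (𝓝[<] 1)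
      (𝓝 (|L - ∫ x, ⟪v (t + 1) x, φ x⟫|)) :=
    ((continuous_abs.tendsto _).comp ((hgv.sub_const _)))
  have hev : ∀ᶠ t' in 𝓝[<] (1 : ℝ), |(∫ x, ⟪v t' x, φ x⟫) - ∫ x, ⟪v (t + 1) x, φ x⟫| ≤
      Mc * (1 - (t + 1)) ^ (1 / 4 : ℝ) := by
    filter_upwards [Ioo_mem_nhdsLT hs1] with t' ht'
    exact hincr (t + 1) t' hs ht'.1.le ht'.2
  have hle := le_of_tendsto hlim hev
  have e1 : v (t + 1) = u t := by simp only [hv, add_sub_cancel_right]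
  rw [e1, show (1 : ℝ) - (t + 1) = -t by ring] at hle
  rwa [abs_sub_comm] at hle

end Summit.NavierStokesRegularity.NavierStokesRegularity.Theorems.FiniteDissipationLiouville.Birth.Apex

end
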